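import Summits.QuantumFields.YangMills.Theorems.ColdStartUniversalityLatticeLangevinWilsonSemigroupPoincareSmoothing
import HarnessLib

/-!
# Route `ColdStartUniversality` (fixed-cut-off `L²(μ_{β'})` package): EXPONENTIAL `L²` DECAY WITH OBSERVABLE-DEPENDENT PREFACTORS IS
# DECAY WITH CONSTANT ONE — only the RATE has to be uniform (Bakry–Gentil–Ledoux Thm 4.2.5 (iii)⇒(ii), by discrete log-convexity)

Helper file (seat `ym-line-csu-p1`, g17; `--supports stmt-QuantumFields-27363`).  For the reversible SZZ kernels at any `L, β'`: if every
continuous observable `G` has SOME constant `C = C(G)` with `∫ (κ_t G − μG)² dμ ≤ C e^{−2λt}` for all `t`, then in fact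
`∫ (κ_t G − μG)² dμ ≤ e^{−2λt} Var_μ(G)` for all `G` and `t` — the prefactor is `1` and multiplies the variance.  Proof (no spectral
theorem): with `Φ(u) = ⟨G₀, κ_u G₀⟩_μ` and `q = Φ(2t)/Φ(0)`, g15's dyadic log-convexity `integral_mul_transition_ge_pow` gives
`Φ(2^k · 2t) ≥ Φ(0) q^{2^k}`, while the hypothesis gives `Φ(2^k · 2t) ≤ C (e^{−2λt})^{2^k}`; so `q ≤ e^{−2λt}`.  g16's
`integral_mul_transition_le_exp_of_mixing` is the same mechanism for a sup-norm (Harris) hypothesis uniform in the starting point; the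
present `L²` form allows ARBITRARY observable-dependent prefactors.

* ★★ `integral_sq_transition_sub_le_exp_of_decay_with_constant` — per-observable exponential `L²` decay at rate `λ` (any prefactors)
  ⇒ (H1)-shape decay at rate `λ` with constant one.

PLANNER-FACING READING (physical units, `λ = c ε_K`; sequel `…UniformColdStartMixingOfUniformRate`): for the K-uniform hypothesis (H1) of
the `L²` line ONLY THE EXPONENTIAL RATE `c ε_K` must be uniform in the cut-off — prefactors may depend on the observable AND on `K` in any
way (e.g. Harris/Lyapunov constants exponential in the number of links are harmless).  THEOREMS ONLY, no definition, no sorry.  HONEST FRAMING: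
RECORD-rung R3 plumbing at FIXED cut-off; nothing K-uniform is proved; no crux, rung or summit statement is proved; the Yang–Mills mass gap
is NOT proved.
-/

set_option autoImplicit false

noncomputable section

namespace Summit.QuantumFields.YangMills.Theorems.ColdStartUniversality

open MeasureTheory ProbabilityTheory Filter Set Topology
open scoped BigOperators NNReal ENNReal
open Literature.Probability.Process Literature.MathematicalPhysics.QuantumFieldTheory
open Literature.MathematicalPhysics.QuantumLattice (fundamentalRep fundamentalLatticeRep continuous_fundamentalRep)

variable {L : ℕ} [NeZero L]

/-- ★★ **Exponential `L²(μ_{β'})` decay with observable-dependent prefactors ⇒ decay with constant one** (Bakry–Gentil–Ledoux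
Thm 4.2.5 (iii)⇒(ii) for the reversible SZZ kernels, by dyadic log-convexity instead of the spectral theorem): if every continuous `G`
admits `C(G)` with `∫ (κ_tG − μG)² dμ ≤ C(G) e^{−2λt}` for all `t`, then `∫ (κ_tG − μG)² dμ ≤ e^{−2λt} Var_μ(G)` for all continuous `G`
and all `t`. [cite: BakryGentilLedoux2014, Thm 4.2.5 (iii)⇒(ii) and Lemma 4.2.6] -/
theorem integral_sq_transition_sub_le_exp_of_decay_with_constant (L : ℕ) [NeZero L] (β' : ℝ)
    (κ : ℝ≥0 → Kernel (GaugeConfig 3 L (Matrix.specialUnitaryGroup (Fin 2) ℂ))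
      (GaugeConfig 3 L (Matrix.specialUnitaryGroup (Fin 2) ℂ))) [∀ t, IsMarkovKernel (κ t)]
    (hreal : ∀ (t : ℝ≥0) (x : GaugeConfig 3 L (Matrix.specialUnitaryGroup (Fin 2) ℂ))
        (Ω : Type) [MeasurableSpace Ω] (P : Measure Ω) [IsProbabilityMeasure P]
        (W : ℝ≥0 → Ω → (Edge 3 L × NoiseIdx 2 → ℝ)) (hW : IsFlatBrownian W P)
        (U : ℝ≥0 → Ω → GaugeConfig 3 L (Matrix.specialUnitaryGroup (Fin 2) ℂ)),
        (∀ ω, U 0 ω = x) →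
        (latticeLangevinDynamics (fundamentalLatticeRep 2) β').IsSolution (fundamentalRep (Fin 2))
          hW.natFiltration P W U →
        κ t x = P.map (U t))
    {lam : ℝ}
    (hdec : ∀ G : GaugeConfig 3 L (Matrix.specialUnitaryGroup (Fin 2) ℂ) → ℝ, Continuous G → ∃ C : ℝ, ∀ t : ℝ≥0,
      ∫ x, ((∫ y, G y ∂(κ t x)) - ∫ z, G z ∂(wilsonMeasure (d := 3) (L := L) (fundamentalRep (Fin 2)) β')) ^ 2
          ∂(wilsonMeasure (d := 3) (L := L) (fundamentalRep (Fin 2)) β') ≤ C * Real.exp (-2 * lam * t))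
    {G : GaugeConfig 3 L (Matrix.specialUnitaryGroup (Fin 2) ℂ) → ℝ} (hG : Continuous G) (t : ℝ≥0) :
    ∫ x, ((∫ y, G y ∂(κ t x)) - ∫ z, G z ∂(wilsonMeasure (d := 3) (L := L) (fundamentalRep (Fin 2)) β')) ^ 2
        ∂(wilsonMeasure (d := 3) (L := L) (fundamentalRep (Fin 2)) β') ≤
      Real.exp (-2 * lam * t) *
        ∫ x, (G x - ∫ z, G z ∂(wilsonMeasure (d := 3) (L := L) (fundamentalRep (Fin 2)) β')) ^ 2
          ∂(wilsonMeasure (d := 3) (L := L) (fundamentalRep (Fin 2)) β') := by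
  classical
  haveI := secondCountableTopology_su2
  haveI := borelSpace_config L
  set μ : Measure (GaugeConfig 3 L (Matrix.specialUnitaryGroup (Fin 2) ℂ)) :=
    wilsonMeasure (d := 3) (L := L) (fundamentalRep (Fin 2)) β' with hμ
  haveI : IsProbabilityMeasure μ :=
    isProbabilityMeasure_wilsonMeasure (d := 3) (L := L) (fundamentalRep (Fin 2)) (continuous_fundamentalRep (Fin 2)) β'
  set m : ℝ := ∫ z, G z ∂μ with hm
  set Vr : ℝ := ∫ x, (G x - m) ^ 2 ∂μ with hVr
  have hVr0 : 0 ≤ Vr := integral_nonneg fun x => sq_nonneg _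
  -- the centred observable and its autocorrelation function
  set G₀ : GaugeConfig 3 L (Matrix.specialUnitaryGroup (Fin 2) ℂ) → ℝ := fun x => G x - m with hG₀
  have hG₀c : Continuous G₀ := hG.sub continuous_const
  obtain ⟨M, hM0, hM⟩ := exists_abs_le_of_continuous hG
  have hGi : ∀ (ν : Measure (GaugeConfig 3 L (Matrix.specialUnitaryGroup (Fin 2) ℂ))) [IsProbabilityMeasure ν],
      Integrable G ν := fun ν _ =>
    Integrable.of_bound hG.aestronglyMeasurable M (Eventually.of_forall fun z => by rw [Real.norm_eq_abs]; exact hM z)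
  have hκG₀ : ∀ (u : ℝ≥0) x, ∫ y, G₀ y ∂(κ u x) = (∫ y, G y ∂(κ u x)) - m := by
    intro u x
    simp only [hG₀]
    rw [integral_sub (hGi _) (integrable_const m), integral_const, probReal_univ, one_smul]
  set Φ : ℝ≥0 → ℝ := fun u => ∫ x, G₀ x * (∫ y, G₀ y ∂(κ u x)) ∂μ with hΦ
  have hκ0 : κ 0 = Kernel.id := transitionKernel_zero_eq_id L β' κ hreal
  have hG₀sq : ∫ x, G₀ x * G₀ x ∂μ = Vr := integral_congr_ae (Eventually.of_forall fun x => by simp only [hG₀]; ring)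
  have hΦ0 : Φ 0 = Vr := by
    simp only [hΦ, hκ0, Kernel.id_apply, integral_dirac]
    exact hG₀sq
  have hΦvar : ∀ s : ℝ≥0, ∫ x, ((∫ y, G y ∂(κ s x)) - m) ^ 2 ∂μ = Φ (s + s) := by
    intro s
    simp only [hΦ]
    rw [integral_mul_transition_self_eq_sq L β' κ hreal s hG₀c]
    exact integral_congr_ae (Eventually.of_forall fun x => by simp only [hκG₀ s x])
  show ∫ x, ((∫ y, G y ∂(κ t x)) - m) ^ 2 ∂μ ≤ Real.exp (-2 * lam * t) * Vr
  rw [hΦvar t]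
  -- the case `Var(G) = 0`: `Φ(2t) ≤ Φ(0) = 0`
  rcases hVr0.lt_or_eq with hVpos | hV0
  swap
  · have hanti := integral_mul_transition_self_antitone L β' κ hreal 0 (t + t) hG₀c
    rw [zero_add] at hanti
    have h0 : Φ (t + t) ≤ Φ 0 := hanti
    rw [hΦ0, ← hV0] at h0
    rw [← hV0, mul_zero]
    exact h0
  -- the case `Var(G) > 0`: suppose `q = Φ(2t)/Vr > r = e^{−2λt}`
  by_contra hcon
  have hlt : Real.exp (-2 * lam * t) * Vr < Φ (t + t) := lt_of_not_ge hcon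
  set r : ℝ := Real.exp (-2 * lam * t) with hr
  have hrpos : 0 < r := Real.exp_pos _
  set q : ℝ := Φ (t + t) / Vr with hq
  have hqr : r < q := by rw [hq, lt_div_iff₀ hVpos]; exact hlt
  have hρ : 1 < q / r := (one_lt_div hrpos).2 hqr
  -- the hypothesis for `G` in terms of `Φ`
  obtain ⟨C, hC⟩ := hdec G hG
  have hCΦ : ∀ s : ℝ≥0, Φ (s + s) ≤ C * Real.exp (-2 * lam * s) := fun s => by rw [← hΦvar s]; exact hC s
  -- dyadic log-convexity: `Vr q^{2^k} ≤ Φ(2^k · 2t) ≤ C r^{2^k}`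
  have hΦ0pos : 0 < ∫ x, G₀ x * G₀ x ∂μ := by rw [hG₀sq]; exact hVpos
  have hkey : ∀ k : ℕ, Vr * (q / r) ^ (2 ^ k) ≤ C := by
    intro k
    have h2k : (2 : ℝ≥0) ^ k ≠ 0 := pow_ne_zero _ two_ne_zero
    -- lower bound
    have hlow := integral_mul_transition_ge_pow L β' κ hreal hG₀c hΦ0pos k ((2 : ℝ≥0) ^ k * (t + t))
    rw [mul_div_cancel_left₀ _ h2k, hG₀sq] at hlow
    have hlow' : Vr * q ^ (2 ^ k) ≤ Φ ((2 : ℝ≥0) ^ k * (t + t)) := by simpa only [hΦ, hq] using hlow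
    -- upper bound
    have hup : Φ ((2 : ℝ≥0) ^ k * (t + t)) ≤ C * r ^ (2 ^ k) := by
      have e : (2 : ℝ≥0) ^ k * (t + t) = (2 : ℝ≥0) ^ k * t + (2 : ℝ≥0) ^ k * t := by ring
      rw [e]
      refine (hCΦ _).trans (le_of_eq ?_)
      rw [hr, ← Real.exp_nat_mul]
      congr 1; push_cast; ring
    -- combine: `Vr (q/r)^{2^k} = Vr q^{2^k} / r^{2^k} ≤ C`
    have hrk : 0 < r ^ (2 ^ k) := pow_pos hrpos _
    rw [div_pow, mul_div_assoc', div_le_iff₀ hrk]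
    exact hlow'.trans hup
  -- but `(q/r)^{2^k} → ∞`
  obtain ⟨n, hn⟩ := (tendsto_pow_atTop_atTop_of_one_lt hρ).eventually_gt_atTop (C / Vr) |>.exists
  have hmono : (q / r) ^ n ≤ (q / r) ^ (2 ^ n) := pow_le_pow_right₀ hρ.le (Nat.lt_two_pow_self).le
  have h1 : C / Vr < (q / r) ^ (2 ^ n) := lt_of_lt_of_le hn hmono
  have h2 : C < Vr * (q / r) ^ (2 ^ n) := by rw [div_lt_iff₀' hVpos] at h1; exact h1
  linarith [hkey n]

end Summit.QuantumFields.YangMills.Theorems.ColdStartUniversality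

end
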